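import Mathlib.LinearAlgebra.Eigenspace.Pi
import Literature.NumberTheory.EllipticCurves.EigenformPrimeLevelNewformProofs
import HarnessLib

/-!
# The newform behind an eigenform of the `T_q` (`q ∤ L`) **and `U_p`** on `S_k(Γ₁(L))` for ANY
# level `L` divisible by `p` (any power) and ANY nebentypus: `a_p` of the newform from a non-zero
# `U_p`-eigenvalue (proofs only)

Topic `Literature/NumberTheory/EllipticCurves`; namespace
`Literature.NumberTheory.EllipticCurves.ModularForms`.  THEOREMS ONLY (no definition, no named
fact; D-0026).  The companion of `exists_isNewform1_of_eigenpacket_of_heckeT_prime`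
(`EigenformPrimeLevelNewformProofs`, level `Np` with `p ∤ N`) in which the level `L` may be
divisible by ANY power of `p` — the situation of a weight-one newform RAMIFIED at `p` (level
divisible by `p²` or `p³` at `p = 2`), as needed for the ramified case of the classical ordinary
lift (Wiles, Invent. Math. 94 (1988), §1; Allen, Compos. Math. 150 (2014), Lemma 87).

**Statement** (`exists_isNewform1_of_eigenpacket_of_heckeT_of_dvd_level`).  Let `p ∣ L` be a prime
and `g ∈ S_k(Γ₁(L))`, `g ≠ 0`, lie in the `χ`-eigenspace of the diamond operators and satisfy
`T_q g = a_q g` for every prime `q ∤ L` and `U_p g = μ g` with `μ ≠ 0`.  Then there are `L₀ ∣ L` and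
a newform `g₀ ∈ S_k(Γ₁(L₀))` with `a_q(g₀) = a_q` for all primes `q ∤ L`, whose nebentypus induces
`χ`, and EITHER `p ∣ L₀` and `a_p(g₀) = μ`, OR `p ∤ L₀` and `μ² - a_p(g₀) μ + ε_{g₀}(p) p^{k-1} = 0`.

**Proof.**  As in `EigenformPrimeLevelNewformProofs`, with the `p`-packet vectors now killed by
`X^j (X - a_p(g₀))` (`p ∣ L₀`) or `X^j Q_{g₀}` (`p ∤ L₀`): on the `p`-old line
`[α_e] b, [α_{pe}] b, [α_{p²e}] b, …` (`p ∤ e`) the operator `U_p` lowers the index,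
`U_p [α_{p^{m+1} e}] b = p^{k-1} [α_{p^m e}] b` (Diamond–Shurman Prop. 5.6.2,
`heckeT_degeneracyMap1_mul`), so a polynomial `S` killing `[α_e] b` gives `X^m S` killing
`[α_{p^m e}] b`; at `μ ≠ 0` the factor `X^j` is harmless.

## References

* A. O. L. Atkin, J. Lehner, *Hecke operators on `Γ₀(m)`*, Math. Ann. 185 (1970), 134–160, §2.
  [AtkinLehner1970]
* F. Diamond, J. Shurman, *A First Course in Modular Forms*, GTM 228 (2005), Prop. 5.6.2,
  Thm. 5.8.2, Thm. 5.8.3. [DiamondShurman2005]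
* W.-C. W. Li, *Newforms and functional equations*, Math. Ann. 212 (1975), Thm. 3. [Li1975]
* A. Wiles, Invent. Math. 94 (1988), 529–573, §1. [Wiles1988]
-/

noncomputable section

open scoped MatrixGroups ModularForm Polynomial

open CongruenceSubgroup Polynomial

namespace Literature.NumberTheory.EllipticCurves.ModularForms

/-! ### Linear algebra -/

section LinearAlgebra

variable {V : Type*} [AddCommGroup V] [Module ℂ V] {W : Type*} [AddCommGroup W] [Module ℂ W]

/-- `Q(U) x = U(U x) - α U x + β x` for `Q = X² - α X + β`. [folklore] -/
private theorem aeval_quadratic_apply'' (U : Module.End ℂ V) (α β : ℂ) (x : V) :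
    aeval U (X ^ 2 - C α * X + C β) x = U (U x) - α • U x + β • x := by
  simp only [map_add, map_sub, map_mul, aeval_X, aeval_C, LinearMap.add_apply,
    LinearMap.sub_apply, Module.End.mul_apply, Module.algebraMap_end_apply, pow_two]

/-- `(X - α)(U) x = U x - α x`. [folklore] -/
private theorem aeval_linear_apply'' (U : Module.End ℂ V) (α : ℂ) (x : V) :
    aeval U (X - C α) x = U x - α • x := by
  simp only [map_sub, aeval_X, aeval_C, LinearMap.sub_apply, Module.algebraMap_end_apply]

/-- Evaluation of `X² - α X + β`. [folklore] -/
private theorem eval_quadratic'' (α β μ : ℂ) :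
    (X ^ 2 - C α * X + C β : ℂ[X]).eval μ = μ ^ 2 - α * μ + β := by
  simp only [eval_add, eval_sub, eval_mul, eval_pow, eval_X, eval_C]

/-- If `U x = a x - c y` and `U y = t x` then `Q(U) x = 0` for `Q = X² - a X + c t`. [folklore] -/
private theorem aeval_quadratic_eq_zero_of_pair' (U : Module.End ℂ V) {x y : V} {a c t : ℂ}
    (hx : U x = a • x - c • y) (hy : U y = t • x) :
    aeval U (X ^ 2 - C a * X + C (c * t)) x = 0 := by
  rw [aeval_quadratic_apply'', hx, map_sub, map_smul, map_smul, hx, hy, smul_sub, smul_smul,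
    smul_smul, smul_smul, mul_comm a c]
  abel

/-- **Intertwiners commute with polynomial calculus**: if `D ∘ U₁ = U₂ ∘ D` then
`D (q(U₁) v) = q(U₂) (D v)` for every polynomial `q`. [folklore] -/
theorem map_aeval_apply_of_comm (D : V →ₗ[ℂ] W) (U₁ : Module.End ℂ V) (U₂ : Module.End ℂ W)
    (h : ∀ v, D (U₁ v) = U₂ (D v)) (q : ℂ[X]) (v : V) : D (aeval U₁ q v) = aeval U₂ q (D v) := by
  induction q using Polynomial.induction_on' generalizing v with
  | add p q hp hq => rw [map_add, map_add, LinearMap.add_apply, LinearMap.add_apply, map_add, hp, hq]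
  | monomial n c =>
    rw [aeval_monomial, aeval_monomial, Module.End.mul_apply, Module.End.mul_apply,
      Module.algebraMap_end_apply, Module.algebraMap_end_apply, map_smul]
    congr 1
    induction n generalizing v with
    | zero => rw [pow_zero, pow_zero, Module.End.one_apply, Module.End.one_apply]
    | succ n ih => rw [pow_succ, pow_succ, Module.End.mul_apply, Module.End.mul_apply, ih, h]

/-- `(q · X)(U) v = q(U) (U v)`. [folklore] -/
private theorem aeval_mul_X_apply (U : Module.End ℂ V) (q : ℂ[X]) (v : V) :
    aeval U (q * X) v = aeval U q (U v) := by
  rw [map_mul, aeval_X, Module.End.mul_apply]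

end LinearAlgebra

/-! ### `U_p` on the `p`-old line `[α_{p^m e}] b` -/

section Line

variable (k : ℤ) {p : ℕ} [NeZero p]

/-- **`X^m S` kills `[α_{p^m e}] b` when `S` kills `[α_e] b`**: on the `p`-old line `U_p` lowers
the index, `U_p [α_{p^{m+1} e}] b = p^{k-1} [α_{p^m e}] b` (`p ∣ L`; Diamond–Shurman Prop. 5.6.2,
second diagram, `heckeT_degeneracyMap1_mul`). [cite: DiamondShurman2005, Prop. 5.6.2] -/
theorem aeval_X_pow_mul_degeneracyMap1_eq_zero (hp : p.Prime) {L L₁ e : ℕ} [NeZero L] [NeZero L₁]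
    [NeZero e] (hpL : p ∣ L) (b : CuspForm (Gamma1 L₁) k) (S : ℂ[X])
    (hS : aeval (heckeT (Gamma1 L) k p) S (degeneracyMap1 L₁ L e k b) = 0) (m : ℕ)
    (hdvd : L₁ * (p ^ m * e) ∣ L) :
    aeval (heckeT (Gamma1 L) k p) (X ^ m * S)
      (haveI : NeZero (p ^ m * e) := ⟨mul_ne_zero (pow_ne_zero _ hp.ne_zero) (NeZero.ne e)⟩;
        degeneracyMap1 L₁ L (p ^ m * e) k b) = 0 := by
  induction m with
  | zero =>
    haveI : NeZero (p ^ 0 * e) := ⟨mul_ne_zero (pow_ne_zero _ hp.ne_zero) (NeZero.ne e)⟩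
    rw [pow_zero, one_mul, degeneracyMap1_congr_index (show p ^ 0 * e = e by rw [pow_zero, one_mul]) b]
    exact hS
  | succ m ih =>
    haveI : NeZero (p ^ m * e) := ⟨mul_ne_zero (pow_ne_zero _ hp.ne_zero) (NeZero.ne e)⟩
    haveI : NeZero (p ^ (m + 1) * e) := ⟨mul_ne_zero (pow_ne_zero _ hp.ne_zero) (NeZero.ne e)⟩
    haveI : NeZero (p * (p ^ m * e)) := ⟨mul_ne_zero hp.ne_zero (NeZero.ne (p ^ m * e))⟩
    have hdvd' : L₁ * (p * (p ^ m * e)) ∣ L := by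
      rw [show p * (p ^ m * e) = p ^ (m + 1) * e by ring]; exact hdvd
    have hdvd'' : L₁ * (p ^ m * e) ∣ L :=
      (mul_dvd_mul_left L₁ (Dvd.intro_left p rfl)).trans hdvd'
    have hU : heckeT (Gamma1 L) k p (degeneracyMap1 L₁ L (p ^ (m + 1) * e) k b) =
        ((p : ℂ) ^ (k - 1)) • degeneracyMap1 L₁ L (p ^ m * e) k b := by
      rw [degeneracyMap1_congr_index (show p ^ (m + 1) * e = p * (p ^ m * e) by ring) b]
      exact heckeT_degeneracyMap1_mul k hdvd' hdvd'' hp hpL b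
    change aeval (heckeT (Gamma1 L) k p) (X ^ (m + 1) * S) (degeneracyMap1 L₁ L (p ^ (m + 1) * e) k b) = 0
    rw [pow_succ, mul_assoc, mul_comm X S, ← mul_assoc, aeval_mul_X_apply, hU, map_smul]
    have ih' : aeval (heckeT (Gamma1 L) k p) (X ^ m * S) (degeneracyMap1 L₁ L (p ^ m * e) k b) = 0 :=
      ih hdvd''
    rw [ih', smul_zero]

end Line

/-! ### `p`-packet vectors span `S_k(Γ₁(L))`, every level -/

section Span

variable (k : ℤ) {p : ℕ} [NeZero p]

set_option maxHeartbeats 1600000 in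
/-- **`S_k(Γ₁(L))` is spanned by `p`-packet vectors** (every level `L`): simultaneous eigenvectors
of the `T_q` (`q ∤ L`) and the `⟨u⟩` carrying the packet of a newform `g₀` of some level `L₀ ∣ L`
which, when `p ∣ L`, are killed by `X^j (X - a_p(g₀))` (`p ∣ L₀`) or by `X^j Q_{g₀}`
(`p ∤ L₀`, `Q_{g₀} = X² - a_p(g₀) X + ε_{g₀}(p) p^{k-1}`) applied to `U_p`, for some `j`.  Strong
induction on the level (Diamond–Shurman, proof of Thm. 5.8.3, with Prop. 5.6.2 for `U_p` on the
old forms). [cite: DiamondShurman2005, Thm. 5.8.3 (proof) and Prop. 5.6.2] -/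
theorem span_pPacketVectors_eq_top_of_dvd_aux (hp : p.Prime) :
    ∀ (L : ℕ) (hL : L ≠ 0), haveI : NeZero L := ⟨hL⟩;
      Submodule.span ℂ {b : CuspForm (Gamma1 L) k |
        ∃ (L₀ : ℕ) (_ : NeZero L₀) (hL₀ : L₀ ∣ L) (g₀ : CuspForm (Gamma1 L₀) k), IsNewform1 g₀ ∧
          (∀ (q : ℕ) (hq : q.Prime), ¬ q ∣ L →
            (haveI : NeZero q := ⟨hq.ne_zero⟩; heckeT (Gamma1 L) k q b) = cuspCoeff g₀ q • b) ∧
          (∀ u : (ZMod L)ˣ, diamondOp L k (u : ZMod L) b =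
            DirichletCharacter.changeLevel hL₀ (nebentypus g₀) (u : ZMod L) • b) ∧
          (p ∣ L →
            (p ∣ L₀ ∧ ∃ j : ℕ, aeval (heckeT (Gamma1 L) k p)
              (X ^ j * (X - C (cuspCoeff g₀ p))) b = 0) ∨
            (¬ p ∣ L₀ ∧ ∃ j : ℕ, aeval (heckeT (Gamma1 L) k p)
              (X ^ j * (X ^ 2 - C (cuspCoeff g₀ p) * X +
                C (nebentypus g₀ (p : ZMod L₀) * (p : ℂ) ^ (k - 1)))) b = 0))} = ⊤ := by
  intro L
  induction L using Nat.strong_induction_on with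
  | _ L ih =>
  intro hL
  haveI : NeZero L := ⟨hL⟩
  apply top_unique
  rw [← oldSubspace1_sup_newSubspace1_holds L k, sup_le_iff]
  constructor
  · -- ### the old subspace: images `[α_d] b` of `p`-packet vectors `b` of the lower levels `L₁`
    rw [oldSubspace1, iSup_le_iff]
    rintro ⟨⟨L₁, d⟩, hL₁, hLd⟩
    haveI hL₁0 : NeZero L₁ := ⟨(Nat.pos_of_mem_properDivisors hL₁).ne'⟩
    have hd0 : d ≠ 0 := fun h ↦ NeZero.ne L (Nat.eq_zero_of_zero_dvd (by simpa [h] using hLd))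
    haveI : NeZero d := ⟨hd0⟩
    have hlt : L₁ < L := (Nat.mem_properDivisors.mp hL₁).2
    have hL₁L : L₁ ∣ L := (dvd_mul_right L₁ d).trans hLd
    have ih₁ := ih L₁ hlt hL₁0.out
    dsimp only at hLd ih₁ ⊢
    rw [LinearMap.range_eq_map, ← ih₁, Submodule.map_span, Submodule.span_le]
    rintro _ ⟨b, ⟨L₀, _, hL₀, g₀, hg₀, hbT, hbD, hbU⟩, rfl⟩
    refine Submodule.subset_span ⟨L₀, inferInstance, hL₀.trans hL₁L, g₀, hg₀, ?_, ?_, ?_⟩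
    · intro q hq hqL
      haveI : NeZero q := ⟨hq.ne_zero⟩
      have hqL₁ : ¬ q ∣ L₁ := fun h ↦ hqL (h.trans hL₁L)
      have hqd : ¬ q ∣ d := fun h ↦ hqL (h.trans ((dvd_mul_left d L₁).trans hLd))
      rw [heckeT_degeneracyMap1_of_not_dvd k hLd hq hqd ⟨fun h ↦ (hqL₁ h).elim, fun h ↦ (hqL h).elim⟩,
        hbT q hq hqL₁, map_smul]
    · intro u
      rw [diamondOp_degeneracyMap1 L k hLd u.isUnit b]
      obtain ⟨u₁, hu₁⟩ := u.isUnit.map (ZMod.castHom hL₁L (ZMod L₁))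
      rw [← hu₁, hbD u₁, map_smul, DirichletCharacter.changeLevel_trans _ hL₀ hL₁L,
        DirichletCharacter.changeLevel_eq_cast_of_dvd _ hL₁L u, hu₁, ZMod.castHom_apply]
    · -- `U_p` on `[α_d] b`: write `d = p^m e`, `p ∤ e`
      intro hpL
      obtain ⟨m, e, hpe, rfl⟩ := Nat.exists_eq_pow_mul_and_not_dvd hd0 p hp.ne_one
      haveI : NeZero e := ⟨fun h ↦ hd0 (by rw [h, mul_zero])⟩
      have hLe : L₁ * e ∣ L := (mul_dvd_mul_left L₁ (Dvd.intro_left (p ^ m) rfl)).trans hLd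
      by_cases hpL₁ : p ∣ L₁
      · -- `p ∣ L₁`: transport the polynomial of `b` to `[α_e] b`, then multiply by `X^m`
        have hcomm : ∀ v : CuspForm (Gamma1 L₁) k,
            heckeT (Gamma1 L) k p (degeneracyMap1 L₁ L e k v) =
              degeneracyMap1 L₁ L e k (heckeT (Gamma1 L₁) k p v) := fun v ↦
          heckeT_degeneracyMap1_of_not_dvd k hLe hp hpe ⟨fun _ ↦ hpL, fun _ ↦ hpL₁⟩ v
        rcases hbU hpL₁ with ⟨hpL₀, j, hbU⟩ | ⟨hpL₀, j, hbU⟩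
        · left
          refine ⟨hpL₀, m + j, ?_⟩
          have hS : aeval (heckeT (Gamma1 L) k p) (X ^ j * (X - C (cuspCoeff g₀ p)))
              (degeneracyMap1 L₁ L e k b) = 0 := by
            rw [← map_aeval_apply_of_comm (degeneracyMap1 L₁ L e k) (heckeT (Gamma1 L₁) k p)
              (heckeT (Gamma1 L) k p) (fun v ↦ (hcomm v).symm), hbU, map_zero]
          have h := aeval_X_pow_mul_degeneracyMap1_eq_zero k hp hpL b _ hS m hLd
          rw [← mul_assoc, ← pow_add] at h
          exact h
        · right
          refine ⟨hpL₀, m + j, ?_⟩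
          have hS : aeval (heckeT (Gamma1 L) k p) (X ^ j * (X ^ 2 - C (cuspCoeff g₀ p) * X +
              C (nebentypus g₀ (p : ZMod L₀) * (p : ℂ) ^ (k - 1)))) (degeneracyMap1 L₁ L e k b) = 0 := by
            rw [← map_aeval_apply_of_comm (degeneracyMap1 L₁ L e k) (heckeT (Gamma1 L₁) k p)
              (heckeT (Gamma1 L) k p) (fun v ↦ (hcomm v).symm), hbU, map_zero]
          have h := aeval_X_pow_mul_degeneracyMap1_eq_zero k hp hpL b _ hS m hLd
          rw [← mul_assoc, ← pow_add] at h
          exact h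
      · -- `p ∤ L₁` (so `p ∤ L₀`): `Q` kills `[α_e] b`, then multiply by `X^m`
        have hpL₀ : ¬ p ∣ L₀ := fun h ↦ hpL₁ (h.trans hL₀)
        have hTb : heckeT (Gamma1 L₁) k p b = cuspCoeff g₀ p • b := hbT p hp hpL₁
        obtain ⟨up, hup⟩ := (ZMod.isUnit_prime_iff_not_dvd hp).mpr hpL₁
        have hcopZ : IsCoprime (p : ℤ) (L₁ : ℤ) :=
          Nat.isCoprime_iff_coprime.2 ((Nat.Prime.coprime_iff_not_dvd hp).2 hpL₁)
        have hε : DirichletCharacter.changeLevel hL₀ (nebentypus g₀) (p : ZMod L₁) =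
            nebentypus g₀ (p : ZMod L₀) := by
          have h := DirichletCharacter.changeLevel_eq_cast_of_dvd' (nebentypus g₀) hL₀ hcopZ
          simpa only [Int.cast_natCast] using h
        have hDb : diamondOp L₁ k (p : ZMod L₁) b = nebentypus g₀ (p : ZMod L₀) • b := by
          rw [← hε, ← hup, hbD up]
        right
        refine ⟨hpL₀, m, ?_⟩
        -- `Q` kills `[α_e] b`
        haveI : NeZero (e * p) := ⟨mul_ne_zero (NeZero.ne e) hp.ne_zero⟩
        haveI : NeZero (p * e) := ⟨mul_ne_zero hp.ne_zero (NeZero.ne e)⟩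
        have hcop : Nat.Coprime p (L₁ * e) :=
          (Nat.Prime.coprime_iff_not_dvd hp).2 fun h ↦ (hp.dvd_mul.mp h).elim hpL₁ hpe
        have hLep : L₁ * (e * p) ∣ L := by
          rw [← mul_assoc]
          exact Nat.Coprime.mul_dvd_of_dvd_of_dvd hcop.symm hLe hpL
        have hLpe : L₁ * (p * e) ∣ L := by rw [mul_comm p e]; exact hLep
        have hx : heckeT (Gamma1 L) k p (degeneracyMap1 L₁ L e k b) =
            cuspCoeff g₀ p • degeneracyMap1 L₁ L e k b -
              nebentypus g₀ (p : ZMod L₀) • degeneracyMap1 L₁ L (p * e) k b := by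
          rw [heckeT_degeneracyMap1_of_dvd_of_not_dvd k hLe hLep hp hpL hpL₁ hpe b, hTb, hDb,
            map_smul, map_smul, degeneracyMap1_congr_index (mul_comm e p) b]
        have hy : heckeT (Gamma1 L) k p (degeneracyMap1 L₁ L (p * e) k b) =
            ((p : ℂ) ^ (k - 1)) • degeneracyMap1 L₁ L e k b :=
          heckeT_degeneracyMap1_mul k hLpe hLe hp hpL b
        have hS := aeval_quadratic_eq_zero_of_pair' (heckeT (Gamma1 L) k p) hx hy
        exact aeval_X_pow_mul_degeneracyMap1_eq_zero k hp hpL b _ hS m hLd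
  · -- ### the new subspace: spanned by newforms, killed by `X - a_p(g₀)` when `p ∣ L`
    rw [← span_newforms1_holds L k, Submodule.span_le]
    intro g₀ hg₀
    refine Submodule.subset_span ⟨L, inferInstance, dvd_rfl, g₀, hg₀, fun q hq _ ↦ ?_, fun u ↦ ?_,
      fun hpL ↦ Or.inl ⟨hpL, 0, ?_⟩⟩
    · haveI : NeZero q := ⟨hq.ne_zero⟩
      exact hg₀.heckeT_apply_eq_cuspCoeff_smul q hq
    · rw [DirichletCharacter.changeLevel_self]
      exact (mem_nebentypusSubspace_iff_diamondOp.mp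
        (IsNewform1.mem_nebentypusSubspace_nebentypus_holds hg₀)) u
    · rw [pow_zero, one_mul, aeval_linear_apply'', hg₀.heckeT_apply_eq_cuspCoeff_smul p hp, sub_self]

end Span

/-! ### The theorem -/

section Main

variable {L p : ℕ} [NeZero L] [NeZero p] {k : ℤ}

set_option maxHeartbeats 800000 in
/-- **The newform behind an eigenform of the `T_q` (`q ∤ L`) and of `U_p` in `S_k(L, χ)`, for any
level `L` divisible by `p` and any `χ`, with NON-ZERO `U_p`-eigenvalue.**  Let `g ∈ S_k(Γ₁(L))`,
`g ≠ 0`, with `⟨u⟩ g = χ(u) g`, `T_q g = a_q g` for every prime `q ∤ L` and `U_p g = μ g`, `μ ≠ 0`.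
Then there are `L₀ ∣ L` and a newform `g₀ ∈ S_k(Γ₁(L₀))` with `a_q(g₀) = a_q` for all primes
`q ∤ L`, whose nebentypus induces `χ`, and EITHER `p ∣ L₀` and `a_p(g₀) = μ`, OR `p ∤ L₀` and
`μ² - a_p(g₀) μ + ε_{g₀}(p) p^{k-1} = 0` (Atkin–Lehner 1970, §2; Diamond–Shurman Prop. 5.6.2 and
Thms. 5.8.2–5.8.3). [cite: DiamondShurman2005, Prop. 5.6.2, Thm. 5.8.2, Thm. 5.8.3] [cite: AtkinLehner1970, §2] -/
theorem exists_isNewform1_of_eigenpacket_of_heckeT_of_dvd_level (hp : p.Prime) (hpL : p ∣ L)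
    {g : CuspForm (Gamma1 L) k} (hg0 : g ≠ 0)
    {χ : DirichletCharacter ℂ L} (hgχ : g ∈ nebentypusSubspace L k χ)
    {a : ℕ → ℂ}
    (hT : ∀ (q : ℕ) (hq : q.Prime), ¬ q ∣ L →
      (haveI : NeZero q := ⟨hq.ne_zero⟩; heckeT (Gamma1 L) k q g) = a q • g)
    {μ : ℂ} (hμ : μ ≠ 0) (hU : heckeT (Gamma1 L) k p g = μ • g) :
    ∃ (L₀ : ℕ) (_ : NeZero L₀) (hL₀ : L₀ ∣ L) (g₀ : CuspForm (Gamma1 L₀) k), IsNewform1 g₀ ∧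
      (∀ q : ℕ, q.Prime → ¬ q ∣ L → cuspCoeff g₀ q = a q) ∧
      DirichletCharacter.changeLevel hL₀ (nebentypus g₀) = χ ∧
      ((p ∣ L₀ ∧ cuspCoeff g₀ p = μ) ∨
        (¬ p ∣ L₀ ∧ μ ^ 2 - cuspCoeff g₀ p * μ + nebentypus g₀ (p : ZMod L₀) * (p : ℂ) ^ (k - 1) = 0)) := by
  classical
  have hgD : ∀ u : (ZMod L)ˣ, diamondOp L k (u : ZMod L) g = χ u • g :=
    mem_nebentypusSubspace_iff_diamondOp.mp hgχ
  -- ### the commuting family `{T_q : q ∤ L} ∪ {⟨u⟩}` and its joint generalised eigenspaces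
  let I : Type := {q : ℕ // q.Prime ∧ ¬ q ∣ L} ⊕ (ZMod L)ˣ
  let F : I → Module.End ℂ (CuspForm (Gamma1 L) k) :=
    Sum.elim (fun q ↦ haveI : NeZero q.1 := ⟨q.2.1.ne_zero⟩; heckeT (Gamma1 L) k q.1)
      (fun u ↦ diamondOp L k (u : ZMod L))
  have hcomm : ∀ i j : I, Commute (F i) (F j) := by
    rintro (⟨q, hq, hqM⟩ | u) (⟨q', hq', hqM'⟩ | v)
    · haveI : NeZero q := ⟨hq.ne_zero⟩
      haveI : NeZero q' := ⟨hq'.ne_zero⟩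
      exact heckeT_comm_holds L k q q'
    · haveI : NeZero q := ⟨hq.ne_zero⟩
      exact heckeT_diamondOp_comm_holds (N := L) (k := k) q (v : ZMod L)
    · haveI : NeZero q' := ⟨hq'.ne_zero⟩
      exact (heckeT_diamondOp_comm_holds (N := L) (k := k) q' (u : ZMod L)).symm
    · exact diamondOp_comm L k _ _
  let V : (I → ℂ) → Submodule ℂ (CuspForm (Gamma1 L) k) :=
    fun θ ↦ ⨅ i, (F i).maxGenEigenspace (θ i)
  have hind : iSupIndep V :=
    Module.End.independent_iInf_maxGenEigenspace_of_forall_mapsTo F fun i j φ ↦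
      Module.End.mapsTo_maxGenEigenspace_of_comm (hcomm j i) φ
  let pk : (ℕ → ℂ) → DirichletCharacter ℂ L → I → ℂ :=
    fun a' χ' ↦ Sum.elim (fun q ↦ a' q.1) (fun u ↦ χ' (u : ZMod L))
  have hmemV : ∀ {b : CuspForm (Gamma1 L) k} {a' : ℕ → ℂ} {χ' : DirichletCharacter ℂ L},
      (∀ (q : ℕ) (hq : q.Prime), ¬ q ∣ L →
        (haveI : NeZero q := ⟨hq.ne_zero⟩; heckeT (Gamma1 L) k q b) = a' q • b) →
      (∀ u : (ZMod L)ˣ, diamondOp L k (u : ZMod L) b = χ' u • b) →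
      b ∈ V (pk a' χ') := by
    intro b a' χ' hT' hD'
    change b ∈ ⨅ i, (F i).maxGenEigenspace (pk a' χ' i)
    rw [Submodule.mem_iInf]
    rintro (⟨q, hq, hqM⟩ | u)
    · exact Module.End.eigenspace_le_maxGenEigenspace
        (Module.End.mem_eigenspace_iff.mpr (hT' q hq hqM))
    · exact Module.End.eigenspace_le_maxGenEigenspace
        (Module.End.mem_eigenspace_iff.mpr (hD' u))
  set θ₀ : I → ℂ := pk a χ with hθ₀
  have hgV : g ∈ V θ₀ := hmemV hT hgD
  -- ### the `θ₀`-sources: `p`-packet vectors with the packet of `g`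
  set U := heckeT (Gamma1 L) k p with hUdef
  let S₀ : Set (CuspForm (Gamma1 L) k) :=
    {x | ∃ (L₀ : ℕ) (_ : NeZero L₀) (hL₀ : L₀ ∣ L) (g₀ : CuspForm (Gamma1 L₀) k),
      IsNewform1 g₀ ∧
      (∀ (q : ℕ) (hq : q.Prime), ¬ q ∣ L →
        (haveI : NeZero q := ⟨hq.ne_zero⟩; heckeT (Gamma1 L) k q x) = cuspCoeff g₀ q • x) ∧
      (∀ u : (ZMod L)ˣ, diamondOp L k (u : ZMod L) x =
        DirichletCharacter.changeLevel hL₀ (nebentypus g₀) (u : ZMod L) • x) ∧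
      (∀ q : ℕ, q.Prime → ¬ q ∣ L → cuspCoeff g₀ q = a q) ∧
      DirichletCharacter.changeLevel hL₀ (nebentypus g₀) = χ ∧
      ((p ∣ L₀ ∧ ∃ j : ℕ, aeval U (X ^ j * (X - C (cuspCoeff g₀ p))) x = 0) ∨
        (¬ p ∣ L₀ ∧ ∃ j : ℕ, aeval U (X ^ j * (X ^ 2 - C (cuspCoeff g₀ p) * X +
          C (nebentypus g₀ (p : ZMod L₀) * (p : ℂ) ^ (k - 1)))) x = 0))}
  let W' : Submodule ℂ (CuspForm (Gamma1 L) k) := ⨆ θ ∈ {θ : I → ℂ | θ ≠ θ₀}, V θ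
  -- ### Claim A: everything lies in `span S₀ ⊔ W'`
  have hA : (⊤ : Submodule ℂ (CuspForm (Gamma1 L) k)) ≤ Submodule.span ℂ S₀ ⊔ W' := by
    rw [← span_pPacketVectors_eq_top_of_dvd_aux k hp L (NeZero.ne L), Submodule.span_le]
    rintro x ⟨L₀, _, hL₀, g₀, hg₀, hxT, hxD, hxU⟩
    set θ : I → ℂ := pk (cuspCoeff g₀) (DirichletCharacter.changeLevel hL₀ (nebentypus g₀)) with hθdef
    have hxV : x ∈ V θ := hmemV hxT hxD
    by_cases hθ : θ = θ₀
    · refine Submodule.mem_sup_left (Submodule.subset_span ?_)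
      have hq0 : ∀ q : ℕ, q.Prime → ¬ q ∣ L → cuspCoeff g₀ q = a q := by
        intro q hq hqL
        have h := congrFun hθ (.inl ⟨q, hq, hqL⟩)
        simpa only [hθdef, hθ₀, pk, Sum.elim_inl] using h
      have hneb : DirichletCharacter.changeLevel hL₀ (nebentypus g₀) = χ := by
        refine MulChar.ext fun u ↦ ?_
        have h := congrFun hθ (.inr u)
        simpa only [hθdef, hθ₀, pk, Sum.elim_inr] using h
      exact ⟨L₀, inferInstance, hL₀, g₀, hg₀, hxT, hxD, hq0, hneb, hxU hpL⟩
    · exact Submodule.mem_sup_right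
        (Submodule.mem_iSup_of_mem θ (Submodule.mem_iSup_of_mem (show θ ∈ {θ | θ ≠ θ₀} from hθ) hxV))
  -- ### Claim B: `g ∈ span S₀`
  have hS₀V : Submodule.span ℂ S₀ ≤ V θ₀ := by
    rw [Submodule.span_le]
    rintro x ⟨L₀, _, hL₀, g₀, -, hxT, hxD, hq0, hneb, -⟩
    refine hmemV (fun q hq hqL ↦ ?_) (fun u ↦ ?_)
    · rw [hxT q hq hqL, hq0 q hq hqL]
    · rw [hxD u, hneb]
  have hgS : g ∈ Submodule.span ℂ S₀ := by
    obtain ⟨s, hs, w, hw, hsw⟩ := Submodule.mem_sup.mp (hA (Submodule.mem_top (x := g)))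
    have hwV : w ∈ V θ₀ := by
      have : w = g - s := eq_sub_of_add_eq' hsw
      rw [this]
      exact (V θ₀).sub_mem hgV (hS₀V hs)
    have hdis : Disjoint (V θ₀) W' :=
      hind.disjoint_biSup (show θ₀ ∉ {θ : I → ℂ | θ ≠ θ₀} from fun h ↦ h rfl)
    have hw0 : w = 0 := (Submodule.disjoint_def.mp hdis) w hwV hw
    rw [hw0, add_zero] at hsw
    rw [← hsw]
    exact hs
  -- ### Claim C: a finite spanning family of sources and the product of their polynomials in `U_p`
  obtain ⟨T, hTS, hgT⟩ := Submodule.mem_span_finite_of_mem_span hgS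
  have hdat : ∀ x : CuspForm (Gamma1 L) k, x ∈ (T : Set _) →
      ∃ P : ℂ[X], aeval U P x = 0 ∧ (P.eval μ = 0 →
        ∃ (L₀ : ℕ) (_ : NeZero L₀) (hL₀ : L₀ ∣ L) (g₀ : CuspForm (Gamma1 L₀) k), IsNewform1 g₀ ∧
          (∀ q : ℕ, q.Prime → ¬ q ∣ L → cuspCoeff g₀ q = a q) ∧
          DirichletCharacter.changeLevel hL₀ (nebentypus g₀) = χ ∧
          ((p ∣ L₀ ∧ cuspCoeff g₀ p = μ) ∨
            (¬ p ∣ L₀ ∧ μ ^ 2 - cuspCoeff g₀ p * μ +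
              nebentypus g₀ (p : ZMod L₀) * (p : ℂ) ^ (k - 1) = 0))) := by
    intro x hx
    obtain ⟨L₀, _, hL₀, g₀, hg₀, -, -, hq0, hneb, hxU⟩ := hTS hx
    rcases hxU with ⟨hpL₀, j, hxU⟩ | ⟨hpL₀, j, hxU⟩
    · refine ⟨_, hxU, fun hev ↦ ?_⟩
      rw [eval_mul, eval_pow, eval_X, mul_eq_zero, eval_sub, eval_X, eval_C] at hev
      rcases hev with hev | hev
      · exact absurd (pow_eq_zero_iff'.mp hev).1 hμ
      · rw [sub_eq_zero] at hev
        exact ⟨L₀, inferInstance, hL₀, g₀, hg₀, hq0, hneb, Or.inl ⟨hpL₀, hev.symm⟩⟩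
    · refine ⟨_, hxU, fun hev ↦ ?_⟩
      rw [eval_mul, eval_pow, eval_X, mul_eq_zero, eval_quadratic''] at hev
      rcases hev with hev | hev
      · exact absurd (pow_eq_zero_iff'.mp hev).1 hμ
      · exact ⟨L₀, inferInstance, hL₀, g₀, hg₀, hq0, hneb, Or.inr ⟨hpL₀, hev⟩⟩
  choose! P hP hP' using hdat
  set Ptot : ℂ[X] := ∏ x ∈ T, P x with hPtot
  have hPx : ∀ x ∈ T, aeval U Ptot x = 0 := by
    intro x hx
    rw [hPtot, ← Finset.prod_erase_mul _ _ hx, map_mul, Module.End.mul_apply]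
    change aeval U (∏ x ∈ T.erase x, P x) (aeval U (P x) x) = 0
    rw [hP x hx, map_zero]
  have hPg : aeval U Ptot g = 0 := by
    obtain ⟨c, -, hc⟩ := Submodule.mem_span_finset.mp hgT
    rw [← hc, map_sum]
    refine Finset.sum_eq_zero fun x hx ↦ ?_
    rw [map_smul, hPx x hx, smul_zero]
  have heig : Module.End.HasEigenvector U μ g := ⟨Module.End.mem_eigenspace_iff.mpr hU, hg0⟩
  have hPμ : Ptot.eval μ = 0 := by
    have h := Module.End.aeval_apply_of_hasEigenvector (p := Ptot) heig
    rw [hPg] at h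
    exact (smul_eq_zero.mp h.symm).resolve_right hg0
  rw [hPtot, eval_prod, Finset.prod_eq_zero_iff] at hPμ
  obtain ⟨x, hx, hxμ⟩ := hPμ
  exact hP' x hx hxμ

end Main

end Literature.NumberTheory.EllipticCurves.ModularForms

end
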